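import Summits.CriticalPhenomena.SAWScalingLimit.Theses.SAWReversalUpgrade

/-!
# `EndpointApproxSwap` for route SAWReversalUpgrade (item stmt-CriticalPhenomena-18012)

An endpoint approximation `(a_δ, b_δ)` of the Dobrushin domain `(D; a, b)` is, read backwards, an
endpoint approximation `(b_δ, a_δ)` of the swapped domain `(D.swap; b, a)`: reachability inside the
discrete domain graph is symmetric (the carrier of `D.swap` is that of `D`), and the marked prime
ends of `D.swap` are those of `D` exchanged (`MarkedDomain.pt_swap_zero` / `pt_swap_one`).

This is the same three-line argument as the library lemma
`Literature.Probability.RandomPlanarGeometry.SAW.IsEndpointApprox.swap`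
(`Literature/Barriers/CriticalPhenomena/SupercriticalSAWSpaceFillingReversible.lean`); it is
repeated here so that this support file imports nothing beyond the route file.
-/

namespace Summit.CriticalPhenomena.SAWScalingLimit.Theorems

open Summit.CriticalPhenomena.SAWScalingLimit.Theses.SAWReversalUpgrade
open Literature.Probability.RandomPlanarGeometry

/-- Item stmt-CriticalPhenomena-18012 (`EndpointApproxSwap`, support of route SAWReversalUpgrade):
for every Dobrushin domain `D` and every endpoint approximation `(a, b)` of `(D; D.pt 0, D.pt 1)`,
the pair `(b, a)` is an endpoint approximation of `D.swap`.  Proof: unfold the route definition;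
reachability in `discreteDomainGraph D.carrier δ` is symmetric, and `D.swap.pt 0 = D.pt 1`,
`D.swap.pt 1 = D.pt 0` (`MarkedDomain.pt_swap_zero/one`) exchange the two convergence clauses. -/
theorem EndpointApproxSwap_proof : EndpointApproxSwap := by
  unfold EndpointApproxSwap
  intro D a b h
  refine ⟨h.reachable.mono fun δ hδ => hδ.symm, ?_, ?_⟩
  · rw [MarkedDomain.pt_swap_zero]
    exact h.tendsto_snd
  · rw [MarkedDomain.pt_swap_one]
    exact h.tendsto_fst

end Summit.CriticalPhenomena.SAWScalingLimit.Theorems
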